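import Literature.NumberTheory.LFunctions.SelbergClassDegreeBounds
import Literature.NumberTheory.LFunctions.DirichletSeriesLongIntervals
import Literature.Analysis.Complex.DirichletSeriesSuperexpDecay
import Mathlib.NumberTheory.LSeries.Convolution
import Mathlib.NumberTheory.LSeries.Deriv
import Mathlib.Analysis.Analytic.IsolatedZeros
import HarnessLib

/-!
# The Selberg class has no elements of degree `0 < d < 1` (discharge of
# `SelbergDatum.degree_eq_zero_of_lt_one`)

Sibling proofs file (D-0014 append protocol) for
`Literature/NumberTheory/LFunctions/SelbergClass.lean`, completing `SelbergClassDegreeBounds.lean`.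
Everything here is PROVED; there are no definitions. Main result:

* `Literature.NumberTheory.LFunctions.SelbergDatum.degree_eq_zero_of_lt_one_holds :
  D.degree_eq_zero_of_lt_one` — if the degree `d = 2∑λⱼ` of a Selberg datum is `< 1`, then
  `d = 0` (Richert 1957; Bochner 1958; Conrey–Ghosh 1993; see Perelli's survey, Thm. 3.5, and
  Steuding, *Value-Distribution of L-Functions*, Thm. 6.1).

## The argument (architecture of Conrey–Ghosh: the Dirichlet series converges absolutely on
## all of `ℂ`, which contradicts the growth forced by the functional equation when `d > 0`)

Suppose `N ≥ 1` gamma factors and `d < 1`. Let `G(s) = (s−1)^m F(s)` (entire, axiom (ii)) and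
remove the possible pole by a Dirichlet polynomial instead of `(s−1)^m`:
`F̃(s) = φ(s)^m G(s)` with `φ(s) = (1 − 2^{1−s})/(s − 1)` (entire; `dslope`), so that
`F̃ = (1 − 2^{1−s})^m F` off `s = 1` and `F̃ = ∑ ã(n) n^{−s}` on `re s > 1` with
`ã = (e ⍟ ·)^m a`, `e = δ₁ − 2δ₂`, `ã(1) = 1`.

1. (`SelbergClassDegreeBounds`) `‖F(−k−1/2+it)‖ ≤ A₀(Q²)^{k+1}(120π²)^N(k+M+|t|)^{d(k+1)+2N}` for
   `k ≥ k₀`, hence the same for `F̃` with an extra factor `8^m (2^m)^k`; `F̃` has finite order in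
   every left-bounded strip (axiom (ii) and `|φ| ≤ C` there).
2. (`Literature.Analysis.Complex.norm_coeff_le_exp_of_leftBound`, the Mellin–Barnes/periodicity
   engine, where `d < 1` is used) `|ã(n)| ≤ M_X e^{−nX}` for every `X`: the Dirichlet series of `F̃`
   converges absolutely on `ℂ`, so `F̃` is bounded on every vertical line; in particular
   `‖F(1/4 + it)‖ ≤ B` for all `t`.
3. (`exists_norm_toFun_quarter_ge`) the functional equation gives
   `‖F(1/4+it)‖ ≥ R (1 + (λ₀t + im μ₀)²/x₀²)^{λ₀/4} ‖F(3/4+it)‖`, and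
   (`Literature.NumberTheory.LFunctions.exists_norm_LSeries_ge_on_long_interval`, `ã(1) = 1`)
   `‖F̃(3/4+it)‖ ≥ 1/2` somewhere in every long interval, so `‖F(1/4+it)‖` is unbounded — a
   contradiction. Hence `N = 0`, i.e. `d = 0`.

This replaces the Perron-formula step of Conrey–Ghosh/Steuding (`a(n) ≪ n^{(1+B)(d−1)/(d+1)+ε}`
with `B` arbitrary) by the smooth Cahen–Mellin weights `e^{−nw}` and the periodicity
`w ↦ w + 2πi`, which avoids truncation errors; the two-step architecture (absolute convergence on
`ℂ`, then the functional equation) is that of Conrey–Ghosh.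

## References

* H.-E. Richert, *Über Dirichletreihen mit Funktionalgleichung*, Acad. Serbe Sci. Publ. Inst.
  Math. **11** (1957), 73–124. [Richert1957] (full bibliographic data under [Richert1957PIM])
* J. B. Conrey, A. Ghosh, *On the Selberg class of Dirichlet series: small degrees*, Duke Math. J.
  **72** (1993), 673–693. [ConreyGhosh1993]
* A. Perelli, *Converse theorems: from the Riemann zeta function to the Selberg class*, Boll.
  UMI **10** (2017; online 2016), 29–53 = arXiv:1605.02354, Thm. 3.5 (read: p. 14 of the arXiv version,
  "Theorem 3.5 (Richert, Bochner, Conrey–Ghosh): there are no functions `F ∈ 𝒮` with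
  `0 < d_F < 1`", deduced from "the Dirichlet series of every `F ∈ 𝒮` with `0 ≤ d_F < 1` is
  absolutely convergent over `ℂ`"). [Perelli2016]
* J. Steuding, *Value-Distribution of L-Functions*, LNM 1877, Springer 2007, Thm. 6.1 (read:
  pp. 98–99 of the held copy, the Perron-formula sketch). [Steuding2007]
-/

noncomputable section

open Complex Filter Topology Set
open scoped ComplexConjugate LSeries.notation

namespace Literature.NumberTheory.LFunctions

namespace SelbergDatum

open Literature.Analysis.SpecialFunctions Literature.Analysis.Complex

variable (D : SelbergDatum)

/-! ## The pole killer `φ(s) = (1 − 2^{1−s})/(s − 1)` -/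

/-- `‖2^w‖ = 2^{re w}`. [folklore] -/
lemma norm_two_cpow (w : ℂ) : ‖(2 : ℂ) ^ w‖ = (2 : ℝ) ^ w.re := by
  rw [show (2 : ℂ) = ((2 : ℕ) : ℂ) by norm_num, Complex.norm_natCast_cpow_of_pos (by norm_num)]
  norm_num

/-- `φ = dslope (z ↦ −2^{1−z}) 1` is entire (removable singularity at `1`). [folklore] -/
lemma differentiable_dslope_two_cpow :
    Differentiable ℂ (dslope (fun z : ℂ ↦ -(2 : ℂ) ^ (1 - z)) 1) := by
  have hf : Differentiable ℂ (fun z : ℂ ↦ -(2 : ℂ) ^ (1 - z)) :=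
    (((differentiable_const _).sub differentiable_id).const_cpow (Or.inl two_ne_zero)).neg
  intro z
  rcases eq_or_ne z 1 with rfl | hz
  · obtain ⟨p, hp⟩ := hf.analyticAt 1
    exact hp.has_fpower_series_dslope_fslope.analyticAt.differentiableAt
  · exact (differentiableAt_dslope_of_ne hz).2 (hf z)

/-- `φ(s) = (1 − 2^{1−s})/(s − 1)` for `s ≠ 1`. [folklore] -/
lemma dslope_two_cpow_of_ne_one {s : ℂ} (hs : s ≠ 1) :
    dslope (fun z : ℂ ↦ -(2 : ℂ) ^ (1 - z)) 1 s = (1 - (2 : ℂ) ^ (1 - s)) / (s - 1) := by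
  rw [dslope_of_ne _ hs, slope_def_field]
  simp only [sub_self, Complex.cpow_zero]
  ring

/-- `φ` is bounded on every half-plane `re s ≥ a` (by continuity on `|s − 1| ≤ 1`, and
`|φ(s)| ≤ 1 + 2^{1−re s}` outside). [folklore] -/
lemma exists_norm_dslope_two_cpow_le (a : ℝ) :
    ∃ C : ℝ, 0 < C ∧ ∀ s : ℂ, a ≤ s.re → ‖dslope (fun z : ℂ ↦ -(2 : ℂ) ^ (1 - z)) 1 s‖ ≤ C := by
  obtain ⟨C₁, hC₁⟩ := (isCompact_closedBall (1 : ℂ) 1).exists_bound_of_continuousOn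
    (differentiable_dslope_two_cpow.continuous.continuousOn)
  refine ⟨max C₁ (1 + (2 : ℝ) ^ (1 - a)), lt_max_of_lt_right (by positivity), fun s hs ↦ ?_⟩
  by_cases hmem : s ∈ Metric.closedBall (1 : ℂ) 1
  · exact (hC₁ s hmem).trans (le_max_left _ _)
  · have hs1 : s ≠ 1 := fun h ↦ hmem (by rw [h]; exact Metric.mem_closedBall_self zero_le_one)
    rw [Metric.mem_closedBall, dist_eq_norm, not_le] at hmem
    rw [dslope_two_cpow_of_ne_one hs1, norm_div]
    refine le_trans ?_ (le_max_right _ _)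
    calc ‖1 - (2 : ℂ) ^ (1 - s)‖ / ‖s - 1‖ ≤ ‖1 - (2 : ℂ) ^ (1 - s)‖ :=
          div_le_self (norm_nonneg _) hmem.le
      _ ≤ ‖(1 : ℂ)‖ + ‖(2 : ℂ) ^ (1 - s)‖ := norm_sub_le _ _
      _ = 1 + (2 : ℝ) ^ (1 - s.re) := by rw [norm_one, norm_two_cpow]; simp
      _ ≤ 1 + (2 : ℝ) ^ (1 - a) := by
          have := Real.rpow_le_rpow_of_exponent_le (by norm_num : (1 : ℝ) ≤ 2)
            (by linarith : 1 - s.re ≤ 1 - a)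
          linarith

/-- `‖1 − 2^{1−s}‖ ≤ 1 + 2^{1 − re s}`. [folklore] -/
lemma norm_one_sub_two_cpow_le (s : ℂ) : ‖1 - (2 : ℂ) ^ (1 - s)‖ ≤ 1 + (2 : ℝ) ^ (1 - s.re) :=
  calc ‖1 - (2 : ℂ) ^ (1 - s)‖ ≤ ‖(1 : ℂ)‖ + ‖(2 : ℂ) ^ (1 - s)‖ := norm_sub_le _ _
    _ = 1 + (2 : ℝ) ^ (1 - s.re) := by rw [norm_one, norm_two_cpow]; simp

/-- `‖1 − 2^{1−s}‖ ≥ 2^{3/4} − 1 > 0` on `re s = 1/4`. [folklore] -/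
lemma norm_one_sub_two_cpow_ge {s : ℂ} (hs : s.re = 1 / 4) :
    (2 : ℝ) ^ (3 / 4 : ℝ) - 1 ≤ ‖1 - (2 : ℂ) ^ (1 - s)‖ := by
  have h := norm_sub_norm_le ((2 : ℂ) ^ (1 - s)) 1
  rw [norm_one, norm_two_cpow, norm_sub_rev] at h
  have : (1 - s).re = 3 / 4 := by simp [hs]; norm_num
  rw [this] at h
  exact h

/-! ## The Dirichlet polynomial `1 − 2^{1−s}` and the modified coefficients -/

/-- The `L`-series of `e = δ₁ − 2δ₂` is `1 − 2^{1−s}` (everywhere). [folklore] -/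
lemma LSeriesHasSum_twoKiller (s : ℂ) :
    LSeriesHasSum (fun n : ℕ ↦ if n = 1 then (1 : ℂ) else if n = 2 then -2 else 0) s
      (1 - (2 : ℂ) ^ (1 - s)) := by
  have h : ∀ n ∉ ({1, 2} : Finset ℕ),
      LSeries.term (fun n : ℕ ↦ if n = 1 then (1 : ℂ) else if n = 2 then -2 else 0) s n = 0 := by
    intro n hn
    simp only [Finset.mem_insert, Finset.mem_singleton, not_or] at hn
    rcases eq_or_ne n 0 with rfl | h0
    · simp
    · rw [LSeries.term_of_ne_zero h0]; simp [hn.1, hn.2]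
  have hsum : HasSum (fun n : ℕ ↦
      LSeries.term (fun n : ℕ ↦ if n = 1 then (1 : ℂ) else if n = 2 then -2 else 0) s n)
      (∑ n ∈ ({1, 2} : Finset ℕ),
        LSeries.term (fun n : ℕ ↦ if n = 1 then (1 : ℂ) else if n = 2 then -2 else 0) s n) :=
    hasSum_sum_of_ne_finset_zero h
  rw [Finset.sum_insert (by norm_num), Finset.sum_singleton,
    LSeries.term_of_ne_zero one_ne_zero, LSeries.term_of_ne_zero two_ne_zero] at hsum
  simp only [if_true, Nat.cast_one, Complex.one_cpow, div_one, show (2 : ℕ) ≠ 1 by norm_num,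
    if_false, Nat.cast_ofNat] at hsum
  have he : (1 : ℂ) + -2 / 2 ^ s = 1 - (2 : ℂ) ^ (1 - s) := by
    rw [Complex.cpow_sub _ _ two_ne_zero, Complex.cpow_one]
    field_simp
    ring
  rw [← he]
  exact hsum

/-- The modified coefficients `ã = (e ⍟ ·)^m a` have summable `L`-series on `re s > 1`, with
`LSeries ã s = (1 − 2^{1−s})^m · LSeries a s`, and `ã(1) = 1`. [folklore] -/
lemma iterate_twoKiller (m : ℕ) {s : ℂ} (hs : 1 < s.re) :
    LSeriesSummable ((fun f : ℕ → ℂ ↦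
        (fun n : ℕ ↦ if n = 1 then (1 : ℂ) else if n = 2 then -2 else 0) ⍟ f)^[m] D.coeff) s ∧
    LSeries ((fun f : ℕ → ℂ ↦
        (fun n : ℕ ↦ if n = 1 then (1 : ℂ) else if n = 2 then -2 else 0) ⍟ f)^[m] D.coeff) s =
      (1 - (2 : ℂ) ^ (1 - s)) ^ m * LSeries D.coeff s := by
  induction m with
  | zero => exact ⟨D.LSeriesSummable_coeff s hs, by simp⟩
  | succ m ih =>
    have he := (LSeriesHasSum_twoKiller s).LSeriesSummable
    rw [Function.iterate_succ_apply']
    refine ⟨he.convolution ih.1, ?_⟩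
    rw [LSeries_convolution' he ih.1, ih.2, (LSeriesHasSum_twoKiller s).LSeries_eq, pow_succ]
    ring

/-- `ã(1) = a(1) = 1`. [folklore] -/
lemma iterate_twoKiller_apply_one (m : ℕ) :
    ((fun f : ℕ → ℂ ↦
        (fun n : ℕ ↦ if n = 1 then (1 : ℂ) else if n = 2 then -2 else 0) ⍟ f)^[m] D.coeff) 1 = 1 := by
  induction m with
  | zero => simpa using D.coeff_one
  | succ m ih =>
    rw [Function.iterate_succ_apply', LSeries.convolution_def]
    simp only [Nat.divisorsAntidiagonal_one, Finset.sum_singleton, if_true, one_mul]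
    exact ih

/-- A sequence with `|f(n)| ≤ M e^{−n}` has an `L`-series converging absolutely everywhere.
[folklore] -/
lemma LSeriesSummable_of_norm_le_exp {f : ℕ → ℂ} {M : ℝ}
    (h : ∀ n : ℕ, n ≠ 0 → ‖f n‖ ≤ M * Real.exp (-(n * (1 : ℝ)))) (s : ℂ) : LSeriesSummable f s := by
  set N : ℕ := ⌈2 - s.re⌉₊ with hN
  refine LSeriesSummable_of_le_const_mul_rpow (x := s.re - 1) (by linarith)
    ⟨|M| * N.factorial, fun n hn ↦ ?_⟩
  have hn1 : (1 : ℝ) ≤ n := by exact_mod_cast Nat.one_le_iff_ne_zero.2 hn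
  have hn0 : (0 : ℝ) < n := by linarith
  -- `e^{-n} ≤ N! n^{-N} ≤ N! n^{s.re - 2}`
  have h1 : Real.exp (-(n * (1 : ℝ))) ≤ N.factorial * (n : ℝ) ^ (s.re - 1 - 1) := by
    have hexp := Real.pow_div_factorial_le_exp (n : ℝ) hn0.le N
    rw [div_le_iff₀ (by positivity)] at hexp
    have hpow : (n : ℝ) ^ (-(N : ℝ)) ≤ (n : ℝ) ^ (s.re - 1 - 1) :=
      Real.rpow_le_rpow_of_exponent_le hn1 (by have := Nat.le_ceil (2 - s.re); rw [← hN] at this; linarith)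
    calc Real.exp (-(n * (1 : ℝ))) = (n : ℝ) ^ N * Real.exp (-(n : ℝ)) * (n : ℝ) ^ (-(N : ℝ)) := by
          rw [Real.rpow_neg hn0.le, Real.rpow_natCast, mul_one]; field_simp
      _ ≤ (Real.exp n * N.factorial) * Real.exp (-(n : ℝ)) * (n : ℝ) ^ (-(N : ℝ)) := by gcongr
      _ = N.factorial * (n : ℝ) ^ (-(N : ℝ)) := by
          rw [mul_comm (Real.exp _), mul_assoc, mul_assoc, ← mul_assoc (Real.exp _),
            ← Real.exp_add, add_neg_cancel, Real.exp_zero, one_mul]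
      _ ≤ N.factorial * (n : ℝ) ^ (s.re - 1 - 1) := by gcongr
  calc ‖f n‖ ≤ M * Real.exp (-(n * (1 : ℝ))) := h n hn
    _ ≤ |M| * Real.exp (-(n * (1 : ℝ))) := by gcongr; exact le_abs_self M
    _ ≤ |M| * (N.factorial * (n : ℝ) ^ (s.re - 1 - 1)) := by gcongr
    _ = |M| * N.factorial * (n : ℝ) ^ (s.re - 1 - 1) := by ring

/-! ## The discharge -/

/-- **There is no element of the Selberg class of degree `0 < d < 1`**: for a Selberg datum `D`,
`D.degree < 1 → D.degree = 0` (Richert 1957; Bochner 1958; Conrey–Ghosh, Duke Math. J. 72 (1993);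
Perelli, Boll. UMI 10 (2017), Thm. 3.5; Steuding, LNM 1877, Thm. 6.1). Architecture of Conrey–Ghosh:
for `0 < d < 1` the Dirichlet series would converge absolutely on all of `ℂ`
(`Literature.Analysis.Complex.norm_coeff_le_exp_of_leftBound` applied to
`F̃ = (1 − 2^{1−s})^m F`, using the growth bound `exists_norm_toFun_left_le` on far-left lines,
where `d < 1` enters), so `F` would be bounded on `re s = 1/4`; but the functional equation
(`exists_norm_toFun_quarter_ge`) and the mean value of `F̃` on `re s = 3/4`
(`exists_norm_LSeries_ge_on_long_interval`, `ã(1) = 1`) make `‖F(1/4+it)‖` unbounded when there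
is at least one gamma factor. Hence there is none, and `d = 2∑λⱼ = 0`. [cite: Richert1957] -/
theorem degree_eq_zero_of_lt_one_holds : D.degree_eq_zero_of_lt_one := by
  intro hd
  by_cases hN : D.numGamma = 0
  · -- no gamma factors: the degree is an empty sum
    have : IsEmpty (Fin D.numGamma) := by rw [hN]; infer_instance
    simp [degree, Finset.univ_eq_empty]
  exfalso
  have j₀ : Fin D.numGamma := ⟨0, Nat.pos_of_ne_zero hN⟩
  have hdeg0 : 0 ≤ D.degree := D.degree_nonneg
  ------------------------------------------------------------------
  -- `F̃ = φ^m G`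
  ------------------------------------------------------------------
  obtain ⟨G, hG, hGF⟩ := D.differentiable
  set Ft : ℂ → ℂ := fun s ↦ dslope (fun z : ℂ ↦ -(2 : ℂ) ^ (1 - z)) 1 s ^ D.polarOrder * G s with hFt
  have hFt_diff : Differentiable ℂ Ft := (differentiable_dslope_two_cpow.pow _).mul hG
  have hFt_eq : ∀ s : ℂ, s ≠ 1 → Ft s = (1 - (2 : ℂ) ^ (1 - s)) ^ D.polarOrder * D.toFun s := by
    intro s hs
    simp only [hFt, dslope_two_cpow_of_ne_one hs, hGF s hs, div_pow]
    have : (s - 1) ^ D.polarOrder ≠ 0 := pow_ne_zero _ (sub_ne_zero.2 hs)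
    field_simp
  have hnormFt : ∀ s : ℂ, s ≠ 1 → ‖Ft s‖ = ‖1 - (2 : ℂ) ^ (1 - s)‖ ^ D.polarOrder * ‖D.toFun s‖ := by
    intro s hs; rw [hFt_eq s hs, norm_mul, norm_pow]
  ------------------------------------------------------------------
  -- the modified coefficients `ã`
  ------------------------------------------------------------------
  set b : ℕ → ℂ := (fun f : ℕ → ℂ ↦
    (fun n : ℕ ↦ if n = 1 then (1 : ℂ) else if n = 2 then -2 else 0) ⍟ f)^[D.polarOrder] D.coeff with hb
  have hb_sum : ∀ s : ℂ, 1 < s.re → LSeriesSummable b s := fun s hs ↦ (D.iterate_twoKiller _ hs).1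
  have hb_eq : ∀ s : ℂ, 1 < s.re → LSeries b s = Ft s := by
    intro s hs
    have hs1 : s ≠ 1 := fun h ↦ by rw [h, Complex.one_re] at hs; exact lt_irrefl _ hs
    rw [(D.iterate_twoKiller _ hs).2, hFt_eq s hs1, D.eqOn_LSeries hs]
  have hb1 : b 1 = 1 := D.iterate_twoKiller_apply_one _
  ------------------------------------------------------------------
  -- (i) finite order of `Ft` in left-bounded strips
  ------------------------------------------------------------------
  obtain ⟨A, B, hAB⟩ := D.finiteOrder
  obtain ⟨C₂, hC₂⟩ := (isCompact_closedBall (0 : ℂ) 2).exists_bound_of_continuousOn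
    hG.continuous.continuousOn
  have hB' : 0 < max B 1 := lt_max_of_lt_right one_pos
  have hA' : 0 ≤ max C₂ |A| := le_trans (abs_nonneg A) (le_max_right _ _)
  have hGb : ∀ s : ℂ, ‖G s‖ ≤ max C₂ |A| * Real.exp (‖s‖ ^ (max B 1)) := by
    intro s
    have hE1 : 1 ≤ Real.exp (‖s‖ ^ (max B 1)) := Real.one_le_exp (by positivity)
    by_cases hs : ‖s‖ ≤ 2
    · calc ‖G s‖ ≤ C₂ := hC₂ s (by simpa [Metric.mem_closedBall, dist_zero_right] using hs)
        _ ≤ max C₂ |A| * 1 := by rw [mul_one]; exact le_max_left _ _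
        _ ≤ max C₂ |A| * Real.exp (‖s‖ ^ (max B 1)) := mul_le_mul_of_nonneg_left hE1 hA'
    · push Not at hs
      have hs1 : s ≠ 1 := by intro h; rw [h, norm_one] at hs; linarith
      have h1 : 1 ≤ ‖s‖ := by linarith
      calc ‖G s‖ = ‖(s - 1) ^ D.polarOrder * D.toFun s‖ := by rw [hGF s hs1]
        _ ≤ A * Real.exp (‖s‖ ^ B) := hAB s hs1
        _ ≤ |A| * Real.exp (‖s‖ ^ B) := mul_le_mul_of_nonneg_right (le_abs_self A) (Real.exp_pos _).le
        _ ≤ |A| * Real.exp (‖s‖ ^ (max B 1)) :=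
            mul_le_mul_of_nonneg_left (Real.exp_le_exp.2
              (Real.rpow_le_rpow_of_exponent_le h1 (le_max_left _ _))) (abs_nonneg A)
        _ ≤ max C₂ |A| * Real.exp (‖s‖ ^ (max B 1)) :=
            mul_le_mul_of_nonneg_right (le_max_right _ _) (Real.exp_pos _).le
  have hfin : ∃ B : ℝ, 0 < B ∧ ∀ k : ℕ, ∃ C : ℝ, ∀ s : ℂ, -(k : ℝ) - 1 / 2 ≤ s.re → s.re ≤ 3 / 2 →
      ‖Ft s‖ ≤ C * Real.exp (‖s‖ ^ B) := by
    refine ⟨max B 1, hB', fun k ↦ ?_⟩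
    obtain ⟨Cφ, hCφ0, hCφ⟩ := exists_norm_dslope_two_cpow_le (-(k : ℝ) - 1 / 2)
    refine ⟨Cφ ^ D.polarOrder * max C₂ |A|, fun s hs _ ↦ ?_⟩
    simp only [hFt, norm_mul, norm_pow]
    calc ‖dslope (fun z : ℂ ↦ -(2 : ℂ) ^ (1 - z)) 1 s‖ ^ D.polarOrder * ‖G s‖
        ≤ Cφ ^ D.polarOrder * (max C₂ |A| * Real.exp (‖s‖ ^ (max B 1))) :=
          mul_le_mul (pow_le_pow_left₀ (norm_nonneg _) (hCφ s hs) _) (hGb s) (norm_nonneg _)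
            (by positivity)
      _ = Cφ ^ D.polarOrder * max C₂ |A| * Real.exp (‖s‖ ^ (max B 1)) := by ring
  ------------------------------------------------------------------
  -- (ii) the bound on the far-left lines for `Ft`
  ------------------------------------------------------------------
  obtain ⟨Mμ, A₀, k₀, hM1, hA₀, hFk⟩ := D.exists_norm_toFun_left_le hd
  have hQ2 : 0 < D.Q ^ 2 := by have := D.Q_pos; positivity
  have hleft : ∃ (d E₀ C₀ C₁ M : ℝ) (k₀ : ℕ), d < 1 ∧ 0 ≤ d ∧ 0 ≤ E₀ ∧ 0 < C₀ ∧ 1 ≤ C₁ ∧ 1 ≤ M ∧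
      ∀ k : ℕ, k₀ ≤ k → ∀ t : ℝ, ‖Ft (((-(k : ℝ) - 1 / 2 : ℝ) : ℂ) + t * I)‖ ≤
        C₀ * C₁ ^ k * ((k : ℝ) + M + |t|) ^ (d * (k + 1) + E₀) := by
    refine ⟨D.degree, 2 * D.numGamma, 8 ^ D.polarOrder * A₀ * D.Q ^ 2 *
      (120 * Real.pi ^ 2) ^ D.numGamma, max 1 (2 ^ D.polarOrder * D.Q ^ 2), Mμ, k₀, hd, hdeg0,
      by positivity, by positivity, le_max_left _ _, hM1, fun k hk t ↦ ?_⟩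
    have hk0 : (0 : ℝ) ≤ k := k.cast_nonneg
    have hs1 : (((-(k : ℝ) - 1 / 2 : ℝ) : ℂ) + t * I) ≠ 1 := by
      intro h; have := congrArg Complex.re h; simp at this; linarith
    have hF := hFk k hk t
    rw [hnormFt _ hs1]
    -- `‖1 - 2^{1-s}‖ ≤ 8 · 2^k`
    have hkill : ‖1 - (2 : ℂ) ^ (1 - (((-(k : ℝ) - 1 / 2 : ℝ) : ℂ) + t * I))‖ ≤ 8 * 2 ^ k := by
      refine (norm_one_sub_two_cpow_le _).trans ?_
      have hre : (1 : ℝ) - (((-(k : ℝ) - 1 / 2 : ℝ) : ℂ) + t * I).re = k + 3 / 2 := by simp; ring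
      rw [hre]
      have h1 : (2 : ℝ) ^ ((k : ℝ) + 3 / 2) ≤ (2 : ℝ) ^ (((k + 2 : ℕ)) : ℝ) :=
        Real.rpow_le_rpow_of_exponent_le (by norm_num) (by push_cast; linarith)
      rw [Real.rpow_natCast, pow_add] at h1
      have h2 : (1 : ℝ) ≤ 2 ^ k := one_le_pow₀ (by norm_num)
      linarith
    have hβ0 : 0 ≤ (k : ℝ) + Mμ + |t| := by linarith [abs_nonneg t]
    have hpow0 : 0 ≤ ((k : ℝ) + Mμ + |t|) ^ (D.degree * (k + 1) + 2 * D.numGamma) :=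
      Real.rpow_nonneg hβ0 _
    calc ‖1 - (2 : ℂ) ^ (1 - (((-(k : ℝ) - 1 / 2 : ℝ) : ℂ) + t * I))‖ ^ D.polarOrder *
          ‖D.toFun (((-(k : ℝ) - 1 / 2 : ℝ) : ℂ) + t * I)‖
        ≤ (8 * 2 ^ k) ^ D.polarOrder * (A₀ * (D.Q ^ 2) ^ (k + 1) * (120 * Real.pi ^ 2) ^ D.numGamma *
            ((k : ℝ) + Mμ + |t|) ^ (D.degree * (k + 1) + 2 * D.numGamma)) :=
          mul_le_mul (pow_le_pow_left₀ (norm_nonneg _) hkill _) hF (norm_nonneg _) (by positivity)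
      _ = 8 ^ D.polarOrder * A₀ * D.Q ^ 2 * (120 * Real.pi ^ 2) ^ D.numGamma *
            (2 ^ D.polarOrder * D.Q ^ 2) ^ k *
            ((k : ℝ) + Mμ + |t|) ^ (D.degree * (k + 1) + 2 * D.numGamma) := by
          rw [mul_pow, mul_pow, ← pow_mul, mul_comm k D.polarOrder, pow_mul, pow_succ]; ring
      _ ≤ 8 ^ D.polarOrder * A₀ * D.Q ^ 2 * (120 * Real.pi ^ 2) ^ D.numGamma *
            (max 1 (2 ^ D.polarOrder * D.Q ^ 2)) ^ k *
            ((k : ℝ) + Mμ + |t|) ^ (D.degree * (k + 1) + 2 * ↑D.numGamma) := by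
          gcongr
          exact le_max_right _ _
  ------------------------------------------------------------------
  -- (iii) the engine: `ã(n)` decays faster than any exponential
  ------------------------------------------------------------------
  have hb32 : LSeriesSummable b ((3 / 2 : ℝ) : ℂ) := hb_sum _ (by simp; norm_num)
  have hΦb : ∀ y : ℝ, Ft (((3 / 2 : ℝ) : ℂ) + y * I) = LSeries b (((3 / 2 : ℝ) : ℂ) + y * I) :=
    fun y ↦ (hb_eq _ (by simp; norm_num)).symm
  have hdec := norm_coeff_le_exp_of_leftBound hFt_diff hb32 hΦb hfin hleft
  obtain ⟨Mx, hMx⟩ := hdec 1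
  have hall : ∀ s : ℂ, LSeriesSummable b s := LSeriesSummable_of_norm_le_exp hMx
  ------------------------------------------------------------------
  -- (iv) `LSeries b` is entire and equals `Ft`; `F` is bounded on `re s = 1/4`
  ------------------------------------------------------------------
  have habs : ∀ s : ℂ, LSeries.abscissaOfAbsConv b < s.re := fun s ↦
    lt_of_le_of_lt (hall ((s.re - 1 : ℝ) : ℂ)).abscissaOfAbsConv_le
      (by simp only [Complex.ofReal_re]; exact_mod_cast (by linarith : s.re - 1 < s.re))
  have hLdiff : Differentiable ℂ (LSeries b) := fun s ↦
    (LSeries_differentiableOn b).differentiableAt ((isOpen_re_gt_EReal _).mem_nhds (habs s))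
  have hLFt : LSeries b = Ft := by
    refine AnalyticOnNhd.eq_of_eventuallyEq (Complex.analyticOnNhd_univ_iff_differentiable.mpr hLdiff)
      (Complex.analyticOnNhd_univ_iff_differentiable.mpr hFt_diff) (z₀ := 2) ?_
    have hopen : IsOpen {s : ℂ | 1 < s.re} := isOpen_lt continuous_const Complex.continuous_re
    filter_upwards [hopen.mem_nhds (show (2 : ℂ) ∈ {s : ℂ | 1 < s.re} by simp)] with s hs
    exact hb_eq s hs
  obtain ⟨B₀, hB₀⟩ : ∃ B₀ : ℝ, (∑' n : ℕ, ‖LSeries.term b ((1 / 4 : ℝ) : ℂ) n‖) = B₀ := ⟨_, rfl⟩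
  have hB₀0 : 0 ≤ B₀ := by rw [← hB₀]; exact tsum_nonneg fun n ↦ norm_nonneg _
  have hFt14 : ∀ t : ℝ, ‖Ft (((1 / 4 : ℝ) : ℂ) + t * I)‖ ≤ B₀ := by
    intro t
    rw [← hLFt, LSeries, ← hB₀]
    have hnorm : Summable fun n ↦ ‖LSeries.term b ((1 / 4 : ℝ) : ℂ) n‖ := summable_norm_iff.2 (hall _)
    have heq : ∀ n, ‖LSeries.term b (((1 / 4 : ℝ) : ℂ) + t * I) n‖ =
        ‖LSeries.term b ((1 / 4 : ℝ) : ℂ) n‖ := fun n ↦ by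
      simp only [LSeries.norm_term_eq, add_re, ofReal_re, mul_re, I_re, mul_zero, ofReal_im, I_im,
        mul_one, sub_self, add_zero]
    calc ‖∑' n, LSeries.term b (((1 / 4 : ℝ) : ℂ) + t * I) n‖
        ≤ ∑' n, ‖LSeries.term b (((1 / 4 : ℝ) : ℂ) + t * I) n‖ :=
          norm_tsum_le_tsum_norm (by simp_rw [heq]; exact hnorm)
      _ = ∑' n, ‖LSeries.term b ((1 / 4 : ℝ) : ℂ) n‖ := tsum_congr heq
  have hc₀ : 0 < (2 : ℝ) ^ (3 / 4 : ℝ) - 1 := by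
    have := Real.one_lt_rpow (by norm_num : (1 : ℝ) < 2) (by norm_num : (0 : ℝ) < 3 / 4); linarith
  have hF14 : ∀ t : ℝ, ‖D.toFun (((1 / 4 : ℝ) : ℂ) + t * I)‖ ≤
      B₀ / ((2 : ℝ) ^ (3 / 4 : ℝ) - 1) ^ D.polarOrder := by
    intro t
    have hs1 : (((1 / 4 : ℝ) : ℂ) + t * I) ≠ 1 := by
      apply ne_of_apply_ne Complex.re; norm_num
    have h1 := hFt14 t
    rw [hnormFt _ hs1] at h1
    have hk : ((2 : ℝ) ^ (3 / 4 : ℝ) - 1) ^ D.polarOrder ≤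
        ‖1 - (2 : ℂ) ^ (1 - (((1 / 4 : ℝ) : ℂ) + t * I))‖ ^ D.polarOrder :=
      pow_le_pow_left₀ hc₀.le (norm_one_sub_two_cpow_ge (by simp)) _
    have hkpos : 0 < ((2 : ℝ) ^ (3 / 4 : ℝ) - 1) ^ D.polarOrder := pow_pos hc₀ _
    rw [le_div_iff₀ hkpos]
    calc ‖D.toFun (((1 / 4 : ℝ) : ℂ) + t * I)‖ * ((2 : ℝ) ^ (3 / 4 : ℝ) - 1) ^ D.polarOrder
        ≤ ‖D.toFun (((1 / 4 : ℝ) : ℂ) + t * I)‖ *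
          ‖1 - (2 : ℂ) ^ (1 - (((1 / 4 : ℝ) : ℂ) + t * I))‖ ^ D.polarOrder :=
          mul_le_mul_of_nonneg_left hk (norm_nonneg _)
      _ ≤ B₀ := by rw [mul_comm]; exact h1
  ------------------------------------------------------------------
  -- (v) the lower bounds on `re s = 1/4` and the contradiction
  ------------------------------------------------------------------
  obtain ⟨R, hR0, hR⟩ := D.exists_norm_toFun_quarter_ge hd j₀
  have hx₀ : 0 < D.lam j₀ / 4 + (D.mu j₀).re :=
    add_pos_of_pos_of_nonneg (by linarith [D.lam_pos j₀]) (D.mu_re_nonneg j₀)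
  have hgrow := tendsto_one_add_sq_div_rpow_atTop (c := (D.mu j₀).im) (D.lam_pos j₀) hx₀
    (by linarith [D.lam_pos j₀] : 0 < D.lam j₀ / 4)
  -- `‖F(3/4+it)‖ ≥ ‖Ft(3/4+it)‖ / 3^m`
  have hF34 : ∀ t : ℝ, ‖Ft (((3 / 4 : ℝ) : ℂ) + t * I)‖ ≤
      3 ^ D.polarOrder * ‖D.toFun (((3 / 4 : ℝ) : ℂ) + t * I)‖ := by
    intro t
    have hs1 : (((3 / 4 : ℝ) : ℂ) + t * I) ≠ 1 := by
      apply ne_of_apply_ne Complex.re; norm_num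
    rw [hnormFt _ hs1]
    refine mul_le_mul_of_nonneg_right (pow_le_pow_left₀ (norm_nonneg _) ?_ _) (norm_nonneg _)
    refine (norm_one_sub_two_cpow_le _).trans ?_
    have hre : (1 : ℝ) - (((3 / 4 : ℝ) : ℂ) + t * I).re = 1 / 4 := by simp; norm_num
    rw [hre]
    have : (2 : ℝ) ^ (1 / 4 : ℝ) ≤ (2 : ℝ) ^ (1 : ℝ) :=
      Real.rpow_le_rpow_of_exponent_le (by norm_num) (by norm_num)
    rw [Real.rpow_one] at this
    linarith
  -- the mean value on `re s = 3/4`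
  obtain ⟨T, hT0, hT⟩ := exists_norm_LSeries_ge_on_long_interval b (σ := (3 / 4 : ℝ)) (hall _)
    one_half_pos
  -- choose `T₀` with the growing factor large on `[T₀, ∞)`
  obtain ⟨Kbig, hKbig⟩ : ∃ K : ℝ, (B₀ / ((2 : ℝ) ^ (3 / 4 : ℝ) - 1) ^ D.polarOrder + 1) *
    (2 * 3 ^ D.polarOrder) / R = K := ⟨_, rfl⟩
  obtain ⟨T₀, hT₀⟩ := (tendsto_atTop_atTop.1 hgrow) Kbig
  obtain ⟨t, ht, hbt⟩ := hT T₀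
  rw [hb1, norm_one] at hbt
  have hLt : (1 : ℝ) / 2 ≤ ‖Ft (((3 / 4 : ℝ) : ℂ) + t * I)‖ := by
    rw [← hLFt]; linarith
  have hF34t : 1 / (2 * 3 ^ D.polarOrder) ≤ ‖D.toFun (((3 / 4 : ℝ) : ℂ) + t * I)‖ := by
    rw [div_le_iff₀ (by positivity)]
    have := hF34 t
    nlinarith
  have hgt : Kbig ≤ (1 + (D.lam j₀ * t + (D.mu j₀).im) ^ 2 / (D.lam j₀ / 4 + (D.mu j₀).re) ^ 2) ^
      (D.lam j₀ / 4) := hT₀ t ht.1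
  have hlow := hR t
  have hup := hF14 t
  -- `‖F(1/4+it)‖ ≥ R · Kbig · 1/(2·3^m) = B₀/c₀^m + 1 > ‖F(1/4+it)‖`
  have hKbig' : R * Kbig * (1 / (2 * 3 ^ D.polarOrder)) =
      B₀ / ((2 : ℝ) ^ (3 / 4 : ℝ) - 1) ^ D.polarOrder + 1 := by
    rw [← hKbig]; field_simp
  have h3 : 0 < (2 : ℝ) * 3 ^ D.polarOrder := by positivity
  have hgt0 : 0 ≤ (1 + (D.lam j₀ * t + (D.mu j₀).im) ^ 2 / (D.lam j₀ / 4 + (D.mu j₀).re) ^ 2) ^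
      (D.lam j₀ / 4) := Real.rpow_nonneg (by positivity) _
  have key : B₀ / ((2 : ℝ) ^ (3 / 4 : ℝ) - 1) ^ D.polarOrder + 1 ≤
      ‖D.toFun (((1 / 4 : ℝ) : ℂ) + t * I)‖ := by
    rw [← hKbig']
    calc R * Kbig * (1 / (2 * 3 ^ D.polarOrder))
        ≤ R * (1 + (D.lam j₀ * t + (D.mu j₀).im) ^ 2 / (D.lam j₀ / 4 + (D.mu j₀).re) ^ 2) ^
            (D.lam j₀ / 4) * ‖D.toFun (((3 / 4 : ℝ) : ℂ) + t * I)‖ := by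
          have hK0 : R * Kbig * (1 / (2 * 3 ^ D.polarOrder)) ≤
              R * (1 + (D.lam j₀ * t + (D.mu j₀).im) ^ 2 / (D.lam j₀ / 4 + (D.mu j₀).re) ^ 2) ^
                (D.lam j₀ / 4) * (1 / (2 * 3 ^ D.polarOrder)) :=
            mul_le_mul_of_nonneg_right (mul_le_mul_of_nonneg_left hgt hR0.le) (by positivity)
          exact hK0.trans (mul_le_mul_of_nonneg_left hF34t (mul_nonneg hR0.le hgt0))
      _ ≤ ‖D.toFun (((1 / 4 : ℝ) : ℂ) + t * I)‖ := hlow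
  linarith

end SelbergDatum

end Literature.NumberTheory.LFunctions
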